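import Mathlib
import HarnessLib
import Literature.Analysis.FluidPDE.ClassicalSolution
import Literature.Analysis.FluidPDE.VectorCalculus
import Summits.NavierStokesRegularity.NavierStokesRegularity.Theorems.UnthreadedRigidityDoorUnthreadedRigidityMixedPairOrderOne
import Summits.NavierStokesRegularity.NavierStokesRegularity.Theorems.UnthreadedRigidityDoorUnthreadedRigidityThreadingJetsSeparableWindow

/-!
# Route `UnthreadedRigidityDoor`, item `UnthreadedRigidity` (W2, stmt-NavierStokesRegularity-27585) — LINE g11-2 «MIXED PAIR»:
# the RUNGS RE-COMPOSED on the landed supports — slice rung ⇐ {O2a, O2b, S-H}, window rung ⇐ {O-W, S-HW}; the linked pair survives order one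

Prover file (engine-1 g72; `--supports stmt-NavierStokesRegularity-27585 --as helper`; route-independent imports).  After `…MixedPairSupports`
(S-D, S-QU, S-L), `…MixedPairOrderOne` (S-X, O1) and `…ThreadingJetsSeparableWindow` (the separable rungs, slice-local V-W), the two rungs of
LINE g11-2 (planner ns-idea-6 g11/g12, sketch v1.4 fdd225c37c2e9dbd; statements BY NAME in `…MixedPairDefs`) reduce to the ORDER-TWO items alone:

* `quadShellOrderTwoRigidity_of_analytic` — S-Q `QuadShellOrderTwoRigidity` for profiles analytic on `(0,∞)` (the form the slice rung uses; S-Q as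
  stated, without analyticity, meets the VIRIAL HORN residual R1 and stays open): `separableOrderTwoRigidityL_of_analytic` at `l = 2` with
  `isSolidHarmonic_quadHarmonic`;
* `quadShellWindowAxisym_of_L4` — S-QW `QuadShellWindowAxisym` for windows with `L⁴` slices (the form the window rung uses; pair windows are `L⁴`):
  `sliceAxisym_at_sepShellL_slice`;
* ★ `firstJet_vanishes_of_linked_holds` — THE LINKED PAIR SURVIVES ORDER ONE, unconditionally (O1 by name);
* ★ `mixedPairOrderTwoRigidity_of_orderTwo : ObliqueVirialRigidity → EquatorialDichotomy → HelmholtzPairDead → MixedPairOrderTwoRigidity`;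
* ★ `mixedPairWindowRigidity_of_reduction : PairWindowReduction → HelmholtzWindowDead → MixedPairWindowRigidity` (S-QW, S-X, S-D, S-U discharged;
  `memLp_four_pairShell`: pair slices are `L⁴`).

HONEST LABEL: bookkeeping of a RUNG line about SPECIAL two-shell data; the order-two items O2a/O2b/S-H and the window items O-W/S-HW remain OPEN
hypotheses; `UnthreadedRigidity` (27585), W2 and NS regularity remain OPEN; nothing here is a statement about Navier–Stokes regularity.  0 kit.
-/

noncomputable section

-- the summit and its single sub-problem share the name (CONVENTIONS §1), as in every Theorems file
set_option linter.dupNamespace false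

namespace Summit.NavierStokesRegularity.NavierStokesRegularity.Theorems.UnthreadedRigidity.MixedPair

open scoped Topology InnerProductSpace
open Filter Set MeasureTheory
open Literature.Analysis.FluidPDE
open Summit.NavierStokesRegularity.NavierStokesRegularity.Theorems.UnthreadedRigidity.ProfileHorn (E3 threadingFlux IsSliceAxisymmetric)
open Summit.NavierStokesRegularity.NavierStokesRegularity.Theorems.UnthreadedRigidity.VirialHorn (e det3 vortAmpL VirialAdmissible sepShellL
  WindowAxisUniform windowAxisUniform_holds memLp_four_sepShellL)
open Summit.NavierStokesRegularity.NavierStokesRegularity.Theorems.UnthreadedRigidity.ThreadingJets (separableOrderTwoRigidityL_of_analytic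
  sliceAxisym_at_sepShellL_slice)

/-! ### small tools -/

/-- the null profile gives the zero shell (private copy of the VIRIAL HORN one-liner). -/
private theorem sepShellL_eq_zero_of_null (H : ℝ → ℝ) (Y : E3 → ℝ) (x₀ : E3) (hH : ∀ r : ℝ, 0 ≤ r → H r = 0) (x : E3) :
    sepShellL H Y x₀ x = 0 := by
  have h0 : (fun x : E3 => (H ‖x - x₀‖ * Y (x - x₀)) • (x - x₀)) = fun _ => (0 : E3) := by
    funext x'
    rw [hH ‖x' - x₀‖ (norm_nonneg _), zero_mul, zero_smul]
  have hc : curl (fun _ : E3 => (0 : E3)) = fun _ => (0 : E3) := by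
    funext z
    ext i
    fin_cases i <;> simp [curl]
  show curl (curl (fun x : E3 => (H ‖x - x₀‖ * Y (x - x₀)) • (x - x₀))) x = 0
  rw [h0, hc, hc]

/-- a pair with null dipole profile is the quadrupole shell (private copy). -/
private theorem pairShell_of_null_left' (H₁ H₂ : ℝ → ℝ) (a : E3) (Q : E3 →L[ℝ] E3) (x₀ : E3) (h : IsNullProfile H₁) :
    pairShell H₁ H₂ a Q x₀ = sepShellL H₂ (quadHarmonic Q) x₀ := by
  funext x
  show sepShellL H₁ (dipoleHarmonic a) x₀ x + sepShellL H₂ (quadHarmonic Q) x₀ x = sepShellL H₂ (quadHarmonic Q) x₀ x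
  rw [sepShellL_eq_zero_of_null H₁ (dipoleHarmonic a) x₀ h x, zero_add]

/-- a pair with null quadrupole profile is the dipole shell (private copy). -/
private theorem pairShell_of_null_right' (H₁ H₂ : ℝ → ℝ) (a : E3) (Q : E3 →L[ℝ] E3) (x₀ : E3) (h : IsNullProfile H₂) :
    pairShell H₁ H₂ a Q x₀ = sepShellL H₁ (dipoleHarmonic a) x₀ := by
  funext x
  show sepShellL H₁ (dipoleHarmonic a) x₀ x + sepShellL H₂ (quadHarmonic Q) x₀ x = sepShellL H₁ (dipoleHarmonic a) x₀ x
  rw [sepShellL_eq_zero_of_null H₂ (quadHarmonic Q) x₀ h x, add_zero]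

/-- PAIR SLICES ARE `L⁴`: the sum of two admissible shells (`memLp_four_sepShellL`, engine-1 g71). -/
theorem memLp_four_pairShell {H₁ H₂ : ℝ → ℝ} {a : E3} {Q : E3 →L[ℝ] E3} (hadm : PairAdmissible H₁ H₂ a Q) (x₀ : E3) :
    MemLp (pairShell H₁ H₂ a Q x₀) 4 volume := by
  obtain ⟨_, hQ, hH₁, hH₂⟩ := hadm
  have h1 := memLp_four_sepShellL 1 H₁ (dipoleHarmonic a) x₀ le_rfl hH₁ (isSolidHarmonic_dipoleHarmonic a)
  have h2 := memLp_four_sepShellL 2 H₂ (quadHarmonic Q) x₀ (by norm_num) hH₂ (isSolidHarmonic_quadHarmonic hQ)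
  exact h1.add h2

/-! ### S-Q and S-QW in the forms the rungs use -/

/-- **S-Q FOR ANALYTIC PROFILES**: a quadrupole shell with profile analytic on `(0,∞)`, left-end slice of a classical solution with decaying
pressure, silent at order two, is an axisymmetric slice (`separableOrderTwoRigidityL_of_analytic` at `l = 2`). -/
theorem quadShellOrderTwoRigidity_of_analytic (t₀ T : ℝ) (u : ℝ → E3 → E3) (p : ℝ → E3 → ℝ) (x₀ : E3) (Q : E3 →L[ℝ] E3) (H₂ : ℝ → ℝ)
    (hT : t₀ < T) (hsol : IsClassicalNSSolutionOn (Set.Ico t₀ T) 1 0 u p)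
    (hp : ∀ t ∈ Set.Ico t₀ T, Tendsto (p t) (cocompact E3) (𝓝 0))
    (hQ : IsTracelessSymmetric Q) (hH : VirialAdmissible 2 H₂) (hHa : AnalyticOnNhd ℝ H₂ (Set.Ioi 0))
    (hu : u t₀ = sepShellL H₂ (quadHarmonic Q) x₀)
    (hj2 : ∀ x : E3, iteratedDerivWithin 2 (fun t => threadingFlux u x₀ t x) (Set.Ici t₀) t₀ = 0) :
    IsSliceAxisymmetric (u t₀) x₀ :=
  separableOrderTwoRigidityL_of_analytic 2 x₀ (quadHarmonic Q) H₂ (by norm_num) hT hsol hp (isSolidHarmonic_quadHarmonic hQ) hH hHa hu hj2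

/-- **S-QW FOR WINDOWS WITH `L⁴` SLICES**: in an unthreaded window all of whose slices are `L⁴`, a slice which is an admissible quadrupole shell is
axisymmetric (`sliceAxisym_at_sepShellL_slice` at `l = 2`). -/
theorem quadShellWindowAxisym_of_L4 {S : Set ℝ} (hS : IsOpen S) {u : ℝ → E3 → E3} {x₀ : E3}
    (hcont : ContinuousOn (Function.uncurry u) (S ×ˢ Set.univ))
    (hdiv : ∀ t ∈ S, VectorCalculus.IsDivFree (u t))
    (hmild : ∀ s ∈ S, ∀ t ∈ S, s < t → ∀ x, u t x =
        Literature.Analysis.UnboundedOperators.heatExtension (u s) (t - s) x - oseenDuhamel 1 s u u t x)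
    (hbdd : ∀ τ ∈ S, ∃ B : ℝ, ∀ t ∈ S, t ≤ τ → ∀ x, ‖u t x‖ ≤ B)
    (hunth : ∀ t ∈ S, ∀ x, inner ℝ (curl (u t) x) (x - x₀) = 0)
    (h4 : ∀ τ ∈ S, MemLp (u τ) 4 volume) {t : ℝ} (ht : t ∈ S) {Q : E3 →L[ℝ] E3} {H : ℝ → ℝ}
    (hQ : IsTracelessSymmetric Q) (hH : VirialAdmissible 2 H) (hu : u t = sepShellL H (quadHarmonic Q) x₀) :
    IsSliceAxisymmetric (u t) x₀ :=
  sliceAxisym_at_sepShellL_slice (l := 2) (by norm_num) hS hcont hdiv hmild hbdd hunth h4 ht hH (isSolidHarmonic_quadHarmonic hQ) hu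

/-! ### The linked pair survives order one, unconditionally -/

/-- ★ **THE BUILT COUNTEREXAMPLE SURVIVES ORDER ONE** (kernel, no hypothesis left): the threading flux of the classical solution issuing from an
admissible LINKED pair has vanishing one-sided first jet at `t₀` — one order more than any separable or isotypic datum survives. -/
theorem firstJet_vanishes_of_linked_holds
    (t₀ T : ℝ) (u : ℝ → E3 → E3) (p : ℝ → E3 → ℝ) (x₀ a : E3) (Q : E3 →L[ℝ] E3) (H₁ H₂ : ℝ → ℝ)
    (hT : t₀ < T) (hsol : IsClassicalNSSolutionOn (Set.Ico t₀ T) 1 0 u p)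
    (hp : ∀ t ∈ Set.Ico t₀ T, Tendsto (p t) (cocompact E3) (𝓝 0))
    (hcd : ∀ x : E3, ContDiffWithinAt ℝ 2 (fun t => threadingFlux u x₀ t x) (Set.Ici t₀) t₀)
    (hadm : PairAdmissible H₁ H₂ a Q) (hu : u t₀ = pairShell H₁ H₂ a Q x₀) (hlink : IsLinked H₁ H₂) :
    ∀ x : E3, iteratedDerivWithin 1 (fun t => threadingFlux u x₀ t x) (Set.Ici t₀) t₀ = 0 := by
  intro x
  rw [orderOneLawPair_holds t₀ T u p x₀ a Q H₁ H₂ hT hsol hp hcd hadm hu x]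
  by_cases hx : x = x₀
  · subst hx
    simp [det3]
  · have hr : 0 < ‖x - x₀‖ := norm_pos_iff.mpr (sub_ne_zero.mpr hx)
    have h0 : H₁ ‖x - x₀‖ * vortAmpL 2 H₂ ‖x - x₀‖ - 3 * (H₂ ‖x - x₀‖ * vortAmpL 1 H₁ ‖x - x₀‖) = 0 :=
      sub_eq_zero.mpr (hlink ‖x - x₀‖ hr)
    rw [h0]
    ring

/-! ### The rungs re-composed -/

/-- ★ **SLICE RUNG ⇐ {O2a, O2b, S-H}**: `MixedPairOrderTwoRigidity` from the three order-two items alone — O1 `orderOneLawPair_holds`, S-L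
`orderOneSilenceLinks_holds`, S-X `coaxialPairAxisym_holds`, S-D `dipoleShellAxisym_holds` and S-Q in analytic form
(`quadShellOrderTwoRigidity_of_analytic`, the rung carries `AnalyticOnNhd ℝ H₂ (Ioi 0)`) are tree theorems. -/
theorem mixedPairOrderTwoRigidity_of_orderTwo (hOb : ObliqueVirialRigidity) (hEq : EquatorialDichotomy) (hH : HelmholtzPairDead) :
    MixedPairOrderTwoRigidity := by
  intro t₀ T u p x₀ a Q H₁ H₂ hT hsol hp hcd hadm hcls hu hA1 hA2 hj1 hj2
  by_cases hco : IsCoaxial a Q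
  · rw [hu]; exact coaxialPairAxisym_holds H₁ H₂ a Q x₀ hadm hco
  · have htr : IsTransverse a Q := hcls.resolve_left hco
    -- how to finish from a null profile
    have null1 : IsNullProfile H₁ → IsSliceAxisymmetric (u t₀) x₀ := by
      intro h1
      have hu' : u t₀ = sepShellL H₂ (quadHarmonic Q) x₀ := by rw [hu]; exact pairShell_of_null_left' H₁ H₂ a Q x₀ h1
      exact quadShellOrderTwoRigidity_of_analytic t₀ T u p x₀ Q H₂ hT hsol hp hadm.2.1 hadm.2.2.2 hA2 hu' hj2
    have null2 : IsNullProfile H₂ → IsSliceAxisymmetric (u t₀) x₀ := by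
      intro h2
      rw [hu, pairShell_of_null_right' H₁ H₂ a Q x₀ h2]
      exact dipoleShellAxisym_holds H₁ a x₀ hadm.1 hadm.2.2.1
    by_cases hq : Q a = 0
    · -- EQUATORIAL: order one links the profiles, order two gives the dichotomy, the Helmholtz branch is dead
      have hlink : IsLinked H₁ H₂ := by
        apply orderOneSilenceLinks_holds H₁ H₂ a Q hadm hco
        intro y
        have key := orderOneLawPair_holds t₀ T u p x₀ a Q H₁ H₂ hT hsol hp hcd hadm hu (y + x₀)
        rw [hj1 (y + x₀)] at key
        simp only [add_sub_cancel_right] at key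
        have : -4 * ((H₁ ‖y‖ * vortAmpL 2 H₂ ‖y‖ - 3 * (H₂ ‖y‖ * vortAmpL 1 H₁ ‖y‖)) * det3 y a (Q y)) = 0 := key.symm
        linarith [this]
      rcases hEq t₀ T u p x₀ a Q H₁ H₂ hT hsol hp hcd hadm hq hco hu hA1 hA2 hlink hj2 with h1 | h2 | hhelm
      · exact null1 h1
      · exact null2 h2
      · rcases hH t₀ T u p x₀ a Q H₁ H₂ hT hsol hp hcd hadm hco hu hhelm hj2 with h1 | h2
        · exact null1 h1
        · exact null2 h2
    · -- OBLIQUE: the isolated virial functional kills the quadrupole (second jet only)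
      exact null2 (hOb t₀ T u p x₀ a Q H₁ H₂ hT hsol hp hcd hadm ⟨htr.1, hq, htr.2 hq⟩ hu hA2 hj2)

/-- ★ **WINDOW RUNG ⇐ {O-W, S-HW}**: `MixedPairWindowRigidity` from the window reduction O-W and S-HW alone — S-QW in `L⁴` form
(`quadShellWindowAxisym_of_L4`; pair windows are `L⁴` by `memLp_four_pairShell`), S-X, S-D and S-U `windowAxisUniform_holds` are tree theorems. -/
theorem mixedPairWindowRigidity_of_reduction (hR : PairWindowReduction) (hHW : HelmholtzWindowDead) : MixedPairWindowRigidity := by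
  intro S hS hconn u x₀ hcont hdiv hmild hbdd hunth hpair
  obtain ⟨a, Q, H₁f, H₂f, hcls, hslice⟩ := hpair
  have h4 : ∀ τ ∈ S, MemLp (u τ) 4 volume := fun τ hτ => by
    rw [(hslice τ hτ).2]; exact memLp_four_pairShell (hslice τ hτ).1 x₀
  have hax : ∀ t ∈ S, IsSliceAxisymmetric (u t) x₀ := by
    intro t ht
    by_cases hco : IsCoaxial a Q
    · rw [(hslice t ht).2]; exact coaxialPairAxisym_holds (H₁f t) (H₂f t) a Q x₀ (hslice t ht).1 hco
    · have htr : IsTransverse a Q := hcls.resolve_left hco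
      have null1 : IsNullProfile (H₁f t) → IsSliceAxisymmetric (u t) x₀ := by
        intro h1
        have hu' : u t = sepShellL (H₂f t) (quadHarmonic Q) x₀ := by
          rw [(hslice t ht).2]; exact pairShell_of_null_left' (H₁f t) (H₂f t) a Q x₀ h1
        exact quadShellWindowAxisym_of_L4 hS hcont hdiv hmild hbdd hunth h4 ht (hslice t ht).1.2.1 (hslice t ht).1.2.2.2 hu'
      have null2 : IsNullProfile (H₂f t) → IsSliceAxisymmetric (u t) x₀ := by
        intro h2
        rw [(hslice t ht).2, pairShell_of_null_right' (H₁f t) (H₂f t) a Q x₀ h2]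
        exact dipoleShellAxisym_holds (H₁f t) a x₀ (hslice t ht).1.1 (hslice t ht).1.2.2.1
      rcases hR S hS u x₀ hcont hdiv hmild hbdd hunth a Q H₁f H₂f htr hco hslice t ht with h1 | h2 | hhelm
      · exact null1 h1
      · exact null2 h2
      · rcases hHW S hS u x₀ hcont hdiv hmild hbdd hunth a Q H₁f H₂f hco hslice t ht hhelm with h1 | h2
        · exact null1 h1
        · exact null2 h2
  exact windowAxisUniform_holds S hS hconn u x₀ hcont hdiv hmild hbdd hax

end Summit.NavierStokesRegularity.NavierStokesRegularity.Theorems.UnthreadedRigidity.MixedPair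

end
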